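import Mathlib
import Summits.Ventures.PercRepro2.Defs
import Summits.Ventures.PercRepro2.Independence
import Summits.Ventures.PercRepro2.Harris
import Summits.Ventures.PercRepro2.Graph
import Summits.Ventures.PercRepro2.PartitionThree

/-!
# Lemma (★P1)₂ — the (P1) Harris chain for a configuration and its complement
(blind cell PercRepro2, mine-a g21; MINE-A.md §68.3)

Under a SYMMETRIC product measure (`p e + p e = 1` for every edge, i.e. the uniform measure on
configurations) the complement map `ω ↦ !ω` preserves the measure and reverses the order.  Hence
the Harris chain of `PartitionThreeUpper.lean` goes through with the second copy replaced by the
COMPLEMENT of the first: for every increasing event `W`, writing `ω̄` for the complement,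
`D' := {a↮b, a↮c}` and `γ := {b↔c}`,

`P(W, a↔b, a↮c, ω̄ ∈ D' ∩ γ) ≤ P(W, a↔b, a↔c, ω̄ ∈ D' ∩ γᶜ)`   (`partitionThree_complement`),

i.e. `#{ω : ω ∈ W ∩ ab|c, ω̄ ∈ bc|a} ≤ #{ω : ω ∈ W ∩ abc, ω̄ ∈ a|b|c}` for the uniform counting
measure.  This is the two-colouring form of lemma (★P1) that appears in the three-copy
(Bernstein) expansion of the (ZC) inequality (one seat, mine-a g21; nothing about (ZC) itself is
claimed here).  Proof: `h := W ∩ {a↔b} ∩ {ω̄ ∈ D'}` is increasing and `{ω̄ ∈ γ}` is decreasing, so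
`P(h ∩ {ω̄ ∈ γ}) ≤ P(h) P({ω̄ ∈ γ}) = P(h) P(γ) ≤ P(h ∩ γ) ≤ P(W ∩ abc ∩ {ω̄ ∈ D'})`; then subtract
the common part `P(W ∩ abc ∩ {ω̄ ∈ D'} ∩ {ω̄ ∈ γ})` from both ends.
-/

namespace Summit.Ventures.PercRepro2

section PartitionThreeComplement

variable {V : Type*} {E : Type*} [Fintype E] [DecidableEq E] {R : Type*} [CommRing R]
  [PartialOrder R] [IsStrictOrderedRing R]

omit [Fintype E] [DecidableEq E] in
/-- The complement configuration `ω̄ = !ω` (every edge flipped). -/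
def complConfig (ω : Config E) : Config E := fun e => !ω e

omit [Fintype E] [DecidableEq E] in
/-- Flipping every edge twice is the identity. -/
lemma complConfig_involutive : Function.Involutive (complConfig (E := E)) := by
  intro ω; funext e; simp [complConfig]

omit [Fintype E] [DecidableEq E] in
/-- The complement map reverses the (pointwise) order on configurations. -/
lemma complConfig_antitone {ω ω' : Config E} (h : ω ≤ ω') : complConfig ω' ≤ complConfig ω := by
  intro e
  have he := h e
  simp only [complConfig]
  rcases Bool.eq_false_or_eq_true (ω e) with h1 | h1 <;>
    rcases Bool.eq_false_or_eq_true (ω' e) with h2 | h2 <;> simp_all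

omit [Fintype E] [DecidableEq E] in
/-- The pull-back `{ω | ω̄ ∈ A}` of an event under the complement map. -/
def complEvent (A : Set (Config E)) : Set (Config E) := complConfig ⁻¹' A

omit [Fintype E] [DecidableEq E] in
/-- `{ω | ω̄ ∈ A}` is decreasing when `A` is increasing. -/
lemma isLowerSet_complEvent {A : Set (Config E)} (hA : IsUpperSet A) :
    IsLowerSet (complEvent A) := by
  intro ω ω' hle hω
  exact hA (complConfig_antitone hle) hω

omit [Fintype E] [DecidableEq E] in
/-- `{ω | ω̄ ∈ A}` is increasing when `A` is decreasing. -/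
lemma isUpperSet_complEvent {A : Set (Config E)} (hA : IsLowerSet A) :
    IsUpperSet (complEvent A) := by
  intro ω ω' hle hω
  exact hA (complConfig_antitone hle) hω

omit [DecidableEq E] in
/-- Under a symmetric weight vector (`p e + p e = 1`, i.e. `p e = ½`) the complement map preserves
the weight of every configuration. -/
lemma weight_complConfig {p : E → R} (hsym : ∀ e, p e + p e = 1) (ω : Config E) :
    weight p (complConfig ω) = weight p ω := by
  unfold weight
  refine Finset.prod_congr rfl fun e _ => ?_
  simp only [complConfig, edgeFactor]
  rcases Bool.eq_false_or_eq_true (ω e) with h | h <;> simp only [h] <;> simp <;>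
    first | linear_combination hsym e | linear_combination -(hsym e)

/-- Under a symmetric weight vector the complement map preserves probabilities:
`P({ω | ω̄ ∈ A}) = P(A)`. -/
lemma prob_complEvent {p : E → R} (hsym : ∀ e, p e + p e = 1) (A : Set (Config E)) :
    prob p (complEvent A) = prob p A := by
  unfold prob
  calc ∑ ω, (complEvent A).indicator (weight p) ω
      = ∑ ω, A.indicator (weight p) (complConfig ω) := by
        refine Finset.sum_congr rfl fun ω _ => ?_
        have hw : weight p ∘ complConfig = weight p := funext (weight_complConfig hsym)
        calc (complEvent A).indicator (weight p) ω
            = (complConfig ⁻¹' A).indicator (weight p ∘ complConfig) ω := by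
              simp only [complEvent, hw]
          _ = A.indicator (weight p) (complConfig ω) := Set.indicator_comp_right complConfig
    _ = ∑ ω, A.indicator (weight p) ω :=
        Equiv.sum_comp (complConfig_involutive (E := E)).toPerm (fun ω => A.indicator (weight p) ω)

/-- **(★P1)₂**: for a symmetric product measure and any increasing event `W`,
`P(W, a↔b, a↮c, ω̄ ∈ {a↮b, a↮c}, ω̄ ∈ {b↔c}) ≤ P(W, a↔b, a↔c, ω̄ ∈ {a↮b, a↮c}, ω̄ ∉ {b↔c})`
— the (P1) Harris chain with the second copy equal to the complement of the first. -/
theorem partitionThree_complement {p : E → R} (hp : IsProbVec p) (hsym : ∀ e, p e + p e = 1)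
    (ends : E → Sym2 V) (a b c : V) {W : Set (Config E)} (hW : IsUpperSet W) :
    prob p (W ∩ connEvent ends a b ∩ (connEvent ends a c)ᶜ ∩
        complEvent ((connEvent ends a b)ᶜ ∩ (connEvent ends a c)ᶜ) ∩
        complEvent (connEvent ends b c)) ≤
      prob p (W ∩ connEvent ends a b ∩ connEvent ends a c ∩
        complEvent ((connEvent ends a b)ᶜ ∩ (connEvent ends a c)ᶜ) ∩
        (complEvent (connEvent ends b c))ᶜ) := by
  -- `h := W ∩ {a↔b} ∩ {ω̄ ∈ D'}` is increasing, `{ω̄ ∈ γ}` is decreasing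
  have hh : IsUpperSet (W ∩ connEvent ends a b ∩
      complEvent ((connEvent ends a b)ᶜ ∩ (connEvent ends a c)ᶜ)) :=
    (hW.inter (isUpperSet_connEvent ends a b)).inter
      (isUpperSet_complEvent (isLowerSet_not_conn_two ends a b c))
  have hγl : IsLowerSet (complEvent (connEvent ends b c)) :=
    isLowerSet_complEvent (isUpperSet_connEvent ends b c)
  -- step 1: `P({ω̄ ∈ γ} ∩ h) ≤ P({ω̄ ∈ γ}) P(h)`
  have h1 := prob_inter_le_prob_mul_prob_of_isLowerSet hp hγl hh
  -- step 2: `P({ω̄ ∈ γ}) = P(γ)`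
  have h2 := prob_complEvent hsym (connEvent ends b c)
  -- step 3: `P(h) P(γ) ≤ P(h ∩ γ)`
  have h3 := prob_mul_prob_le_prob_inter hp hh (isUpperSet_connEvent ends b c)
  -- step 4: `h ∩ γ ⊆ W ∩ {a↔b} ∩ {a↔c} ∩ {ω̄ ∈ D'}`
  have h4 : prob p (W ∩ connEvent ends a b ∩
        complEvent ((connEvent ends a b)ᶜ ∩ (connEvent ends a c)ᶜ) ∩ connEvent ends b c) ≤
      prob p (W ∩ connEvent ends a b ∩ connEvent ends a c ∩
        complEvent ((connEvent ends a b)ᶜ ∩ (connEvent ends a c)ᶜ)) := by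
    refine prob_mono hp ?_
    rintro ω ⟨⟨⟨hw, hab⟩, hd⟩, hbc⟩
    exact ⟨⟨⟨hw, hab⟩, conn_trans hab hbc⟩, hd⟩
  -- the chain: `P(h ∩ {ω̄ ∈ γ}) ≤ P(W ∩ abc ∩ {ω̄ ∈ D'})`
  have hmain : prob p (W ∩ connEvent ends a b ∩
        complEvent ((connEvent ends a b)ᶜ ∩ (connEvent ends a c)ᶜ) ∩
        complEvent (connEvent ends b c)) ≤
      prob p (W ∩ connEvent ends a b ∩ connEvent ends a c ∩
        complEvent ((connEvent ends a b)ᶜ ∩ (connEvent ends a c)ᶜ)) := by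
    rw [Set.inter_comm _ (complEvent (connEvent ends b c))]
    refine h1.trans ?_
    rw [h2, mul_comm]
    exact h3.trans h4
  -- split the left side by `{a↔c}` and the right side by `{ω̄ ∈ γ}`; the two middle parts coincide
  have hX := prob_inter_add_prob_inter_compl p (W ∩ connEvent ends a b ∩
      complEvent ((connEvent ends a b)ᶜ ∩ (connEvent ends a c)ᶜ) ∩
      complEvent (connEvent ends b c)) (connEvent ends a c)
  have hY := prob_inter_add_prob_inter_compl p (W ∩ connEvent ends a b ∩ connEvent ends a c ∩
      complEvent ((connEvent ends a b)ᶜ ∩ (connEvent ends a c)ᶜ)) (complEvent (connEvent ends b c))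
  have hmid : W ∩ connEvent ends a b ∩
        complEvent ((connEvent ends a b)ᶜ ∩ (connEvent ends a c)ᶜ) ∩
        complEvent (connEvent ends b c) ∩ connEvent ends a c =
      W ∩ connEvent ends a b ∩ connEvent ends a c ∩
        complEvent ((connEvent ends a b)ᶜ ∩ (connEvent ends a c)ᶜ) ∩
        complEvent (connEvent ends b c) := by
    ext ω; simp only [Set.mem_inter_iff]; tauto
  have hL : W ∩ connEvent ends a b ∩ (connEvent ends a c)ᶜ ∩
        complEvent ((connEvent ends a b)ᶜ ∩ (connEvent ends a c)ᶜ) ∩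
        complEvent (connEvent ends b c) =
      W ∩ connEvent ends a b ∩
        complEvent ((connEvent ends a b)ᶜ ∩ (connEvent ends a c)ᶜ) ∩
        complEvent (connEvent ends b c) ∩ (connEvent ends a c)ᶜ := by
    ext ω; simp only [Set.mem_inter_iff, Set.mem_compl_iff]; tauto
  rw [hL]
  rw [hmid] at hX
  set Γ := complEvent (connEvent ends b c) with hΓd
  set X := W ∩ connEvent ends a b ∩
    complEvent ((connEvent ends a b)ᶜ ∩ (connEvent ends a c)ᶜ) ∩ Γ with hXd
  set Y := W ∩ connEvent ends a b ∩ connEvent ends a c ∩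
    complEvent ((connEvent ends a b)ᶜ ∩ (connEvent ends a c)ᶜ) with hYd
  calc prob p (X ∩ (connEvent ends a c)ᶜ) = prob p X - prob p (Y ∩ Γ) := by linear_combination hX
    _ ≤ prob p Y - prob p (Y ∩ Γ) := sub_le_sub_right hmain _
    _ = prob p (Y ∩ Γᶜ) := by linear_combination -hY

end PartitionThreeComplement

end Summit.Ventures.PercRepro2
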